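/-
Lane (xiv-h) «MASS-AWARE CEILING» part 4/5 — MECHANICAL CARVE (rh-split-typer-3 g2, RULING #292 (c)) of zd-neg GEN-18
`HOME/rh-split-zd-neg/g18/tree/MassAwareSamplingCeiling.lean` sha16 60d461fef9600800 (1191 l): source lines 811–1080 VERBATIM
(cut at the source's `###` section-doc seams); only this header, the imports, the namespace brackets and 2 insert-only one-line docstring(s) (gate `lint.docstring`, repair xivh-a) are added per part.
Nothing here bears on the truth of RH.
-/
import Summits.RiemannHypothesis.RiemannHypothesis.Theorems.Splittings.MassAwareSamplingCeilingC

/-!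
# Splittings — zd-neg GEN-18 «MASS-AWARE CEILING» (the node `MassAwareSamplingL L 2 θ` is FALSE for every `θ ≥ 2/5`), part 4/5
(source sections G18.4): visibility of the ring moons through the strip certificate.
Full provenance, audit notes and the section map are in the source header (zd-neg g18, card `cards/SPLIT-zd-neg.md` GEN-18).

HONEST LABEL: «SPLITTING SEARCH over kernel-typed RH-EQUIVALENCES; a splitting A ∧ B ⟹ RH is CONDITIONAL bookkeeping
unless A and B are both proved; nothing here bears on the truth of RH.»
-/

set_option linter.dupNamespace false

noncomputable section

open scoped Classical ComplexConjugate
open Set Filter Topology Complex MeasureTheory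

namespace Summit.RiemannHypothesis.RiemannHypothesis.Theorems.Splittings.MassAwareSamplingCeiling

open Summit.RiemannHypothesis.RiemannHypothesis.Theorems.Splittings.BombieriTruncMassAware (Phi LocBand MassAwareSampling)

/-! ### G18.4 Visibility of the ring moons through the strip certificate

For `pL = 2π` the planets are INVISIBLE (`sin(p·j·L/2) = sin(jπ) = 0`).  A moon `ξ = p·j ± c` has `|sin(ξL/2)| = |sin(cL/2)| ≤ cL/2`; on the
NEAR shells `|j| ≤ 2` we use `|sin(ξ(2−L)/2)| ≤ |ξ|(2−L)/2` (so `mvis² ≤ c²L²(2−L)²`), on the FAR shells `|j| ≥ 3` we use `|sin| ≤ 1` and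
`|ξ| ≥ p|j| − η` (so `mvis² ≤ 4c²L²/(p|j|−η)²`); the far tail telescopes. -/

/-- SHELL MAJORANT (after the common factor `4c²L²`): near shells `a²` (`a = (2−L)/2`), far shells `1/(p·x − η)²`. -/
def Bsh (a p η x : ℝ) : ℝ := if x < 3 then a ^ 2 else 1 / (p * x - η) ^ 2

/-- its telescoping primitive. -/
def Vsh (a p η : ℝ) (n : ℕ) : ℝ :=
  if n < 3 then a ^ 2 * (3 - (n : ℝ)) + 1 / p ^ 2 / (5 / 2 - η / p) else 1 / p ^ 2 / ((n : ℝ) - η / p - 1 / 2)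

/-- The shell majorant `Vsh a p η n` is nonnegative (`p > 0`, `0 ≤ η`, `η/p < 1/2`). PURE. -/
theorem Vsh_nonneg {a p η : ℝ} (hp : 0 < p) (_hη : 0 ≤ η) (hγ : η / p < 1 / 2) (n : ℕ) : 0 ≤ Vsh a p η n := by
  unfold Vsh
  split_ifs with h
  · have hn : (n : ℝ) < 3 := by exact_mod_cast h
    have h1 : 0 ≤ a ^ 2 * (3 - (n : ℝ)) := mul_nonneg (sq_nonneg _) (by linarith)
    have h2 : 0 ≤ 1 / p ^ 2 / (5 / 2 - η / p) := div_nonneg (by positivity) (by linarith)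
    linarith
  · push Not at h
    have hn : (3 : ℝ) ≤ n := by exact_mod_cast h
    exact div_nonneg (by positivity) (by linarith)

/-- Telescoping domination `Bsh a p η n ≤ Vsh a p η n − Vsh a p η (n+1)`. PURE. -/
theorem Bsh_le_Vsh_sub {a p η : ℝ} (hp : 0 < p) (hη : 0 ≤ η) (hγ : η / p < 1 / 2) (n : ℕ) :
    Bsh a p η n ≤ Vsh a p η n - Vsh a p η (n + 1) := by
  unfold Bsh Vsh
  push_cast
  by_cases h3 : n < 3
  · have hn3 : (n : ℝ) < 3 := by exact_mod_cast h3
    rw [if_pos hn3, if_pos h3]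
    by_cases h2 : n + 1 < 3
    · rw [if_pos h2]
      linarith
    · rw [if_neg h2]
      have hn : n = 2 := by omega
      subst hn
      push_cast
      have e : (2 : ℝ) + 1 - η / p - 1 / 2 = 5 / 2 - η / p := by ring
      rw [e]
      linarith
  · have hn3 : ¬ ((n : ℝ) < 3) := by exact_mod_cast h3
    have h4 : ¬ (n + 1 < 3) := by omega
    rw [if_neg hn3, if_neg h3, if_neg h4]
    push Not at h3
    have hn : (3 : ℝ) ≤ n := by exact_mod_cast h3
    have hγ0 : 0 ≤ η / p := div_nonneg hη hp.le
    set y : ℝ := (n : ℝ) - η / p with hy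
    have hy5 : 5 / 2 ≤ y := by rw [hy]; linarith
    have e1 : p * (n : ℝ) - η = p * y := by rw [hy, mul_sub, mul_div_cancel₀ _ hp.ne']
    have e2 : (n : ℝ) + 1 - η / p - 1 / 2 = y + 1 / 2 := by rw [hy]; ring
    have e3 : (n : ℝ) - η / p - 1 / 2 = y - 1 / 2 := by rw [hy]
    rw [e1, e2, e3]
    have e4 : 1 / p ^ 2 / (y - 1 / 2) - 1 / p ^ 2 / (y + 1 / 2) = 1 / p ^ 2 / (y ^ 2 - 1 / 4) := by
      have h1 : y - 1 / 2 ≠ 0 := by linarith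
      have h2 : y + 1 / 2 ≠ 0 := by linarith
      rw [div_eq_mul_one_div (1 / p ^ 2) (y - 1 / 2), div_eq_mul_one_div (1 / p ^ 2) (y + 1 / 2),
        div_eq_mul_one_div (1 / p ^ 2) (y ^ 2 - 1 / 4), ← mul_sub]
      congr 1
      rw [div_sub_div _ _ h1 h2, show (y - 1 / 2) * (y + 1 / 2) = y ^ 2 - 1 / 4 by ring]
      congr 1
      ring
    rw [e4, mul_pow, ← div_div]
    exact div_le_div_of_nonneg_left (by positivity) (by nlinarith) (by linarith)

/-- `Σ_{|j| ≤ m} Bsh(|j|) ≤ 5a² + 2T`, `T = (1/p²)/(5/2 − η/p)` (near shells `j = 0, ±1, ±2` pay `a²` each; the two far tails telescope). -/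
theorem sum_Bsh_le {a p η : ℝ} (hp : 0 < p) (hη : 0 ≤ η) (hγ : η / p < 1 / 2) (m : ℕ) :
    ∑ k : Fin (2 * m + 1), Bsh a p η |((k : ℕ) : ℝ) - m| ≤ 5 * a ^ 2 + 2 * (1 / p ^ 2 / (5 / 2 - η / p)) := by
  have hVpos := Vsh_nonneg (a := a) hp hη hγ
  have hterm := Bsh_le_Vsh_sub (a := a) hp hη hγ
  have hV0 : Vsh a p η 0 = 3 * a ^ 2 + 1 / p ^ 2 / (5 / 2 - η / p) := by
    simp only [Vsh, Nat.cast_zero, show (0 : ℕ) < 3 from by norm_num, if_true]; ring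
  have hV1 : Vsh a p η 1 = 2 * a ^ 2 + 1 / p ^ 2 / (5 / 2 - η / p) := by
    simp only [Vsh, Nat.cast_one, show (1 : ℕ) < 3 from by norm_num, if_true]; ring
  rw [Fin.sum_univ_eq_sum_range (fun i : ℕ ↦ Bsh a p η |(i : ℝ) - (m : ℝ)|) (2 * m + 1),
    show 2 * m + 1 = (m + 1) + m by ring, Finset.sum_range_add]
  have hsplit : Vsh a p η 0 + Vsh a p η 1 = 5 * a ^ 2 + 2 * (1 / p ^ 2 / (5 / 2 - η / p)) := by rw [hV0, hV1]; ring
  rw [← hsplit]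
  refine add_le_add ?_ ?_
  · have hcongr : ∀ i ∈ Finset.range (m + 1),
        Bsh a p η |(i : ℝ) - (m : ℝ)| = Bsh a p η (((m + 1 - 1 - i : ℕ) : ℝ)) := by
      intro i hi
      rw [Finset.mem_range] at hi
      have hi' : i ≤ m := by omega
      have hc : ((m + 1 - 1 - i : ℕ) : ℝ) = (m : ℝ) - i := by
        rw [show m + 1 - 1 - i = m - i by omega, Nat.cast_sub hi']
      have hi'' : (i : ℝ) ≤ m := by exact_mod_cast hi'
      rw [hc, abs_of_nonpos (by linarith), neg_sub]
    rw [Finset.sum_congr rfl hcongr, Finset.sum_range_reflect (fun j ↦ Bsh a p η ((j : ℕ) : ℝ)) (m + 1)]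
    calc ∑ j ∈ Finset.range (m + 1), Bsh a p η ((j : ℕ) : ℝ)
        ≤ ∑ j ∈ Finset.range (m + 1), (Vsh a p η j - Vsh a p η (j + 1)) := Finset.sum_le_sum fun j _ ↦ hterm j
      _ = Vsh a p η 0 - Vsh a p η (m + 1) := Finset.sum_range_sub' (Vsh a p η) (m + 1)
      _ ≤ Vsh a p η 0 := by linarith [hVpos (m + 1)]
  · have hcongr : ∀ x ∈ Finset.range m,
        Bsh a p η |((m + 1 + x : ℕ) : ℝ) - (m : ℝ)| = Bsh a p η (((x + 1 : ℕ) : ℝ)) := by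
      intro x _
      push_cast
      rw [show (m : ℝ) + 1 + x - m = x + 1 by ring, abs_of_nonneg (by positivity)]
    rw [Finset.sum_congr rfl hcongr]
    calc ∑ x ∈ Finset.range m, Bsh a p η (((x + 1 : ℕ) : ℝ))
        ≤ ∑ x ∈ Finset.range m, (Vsh a p η (x + 1) - Vsh a p η (x + 1 + 1)) := Finset.sum_le_sum fun x _ ↦ hterm (x + 1)
      _ = Vsh a p η (0 + 1) - Vsh a p η (m + 1) := Finset.sum_range_sub' (fun x ↦ Vsh a p η (x + 1)) m
      _ ≤ Vsh a p η 1 := by rw [zero_add]; linarith [hVpos (m + 1)]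

/-- PLANETS ARE INVISIBLE: `mvis L (p·j) = 0` when `pL = 2π`. -/
theorem mvis_planet {p L : ℝ} (hpL : p * L = 2 * Real.pi) (j : ℤ) : mvis L (p * j) = 0 := by
  rcases eq_or_ne (p * (j : ℝ)) 0 with h0 | hne
  · rw [h0]; simp [mvis]
  · rw [mvis_eq hne]
    have e : p * j * L / 2 = 0 + j * Real.pi := by linear_combination (j : ℝ) / 2 * hpL
    rw [e, Real.sin_add_int_mul_pi, Real.sin_zero]
    simp

/-- **RING-MOON BOUND.**  For `pL = 2π`, `L ≤ 2`, a moon `ξ = p·j + σc` (`σ = ±1`, `0 < c ≤ η`, `η/p < 1/2`):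
`mvis(L,ξ)² ≤ 4c²L² · Bsh((2−L)/2, p, η, |j|)`. -/
theorem mvis_sq_ring_le {p η L c σ ξ : ℝ} {j : ℤ} (hp : 0 < p) (hpL : p * L = 2 * Real.pi) (hL : L ≤ 2)
    (hc0 : 0 < c) (hcη : c ≤ η) (hγ : η / p < 1 / 2) (hσ : σ = 1 ∨ σ = -1) (hξ : ξ = p * j + σ * c) :
    mvis L ξ ^ 2 ≤ 4 * c ^ 2 * L ^ 2 * Bsh ((2 - L) / 2) p η |(j : ℝ)| := by
  have hs : 0 ≤ 2 - L := by linarith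
  have hL0 : 0 < L := by nlinarith [Real.pi_gt_three]
  have hηp : η < p / 2 := by
    have := (div_lt_iff₀ hp).mp hγ
    linarith
  have hσabs : |σ| = 1 := by rcases hσ with h1 | h1 <;> rw [h1] <;> simp
  have hsin : |Real.sin (ξ * L / 2)| ≤ c * L / 2 := by
    have hcL : |Real.sin (σ * c * L / 2)| ≤ c * L / 2 := by
      have h := Real.abs_sin_le_abs (x := σ * c * L / 2)
      have e : |σ * c * L / 2| = c * L / 2 := by
        rw [abs_div, abs_mul, abs_mul, hσabs, one_mul, abs_of_pos hc0, abs_of_pos hL0, abs_two]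
      rw [e] at h
      exact h
    have e : ξ * L / 2 = σ * c * L / 2 + j * Real.pi := by rw [hξ]; linear_combination (j : ℝ) / 2 * hpL
    rw [e, Real.sin_add_int_mul_pi, abs_mul, abs_neg_one_zpow, one_mul]
    exact hcL
  have hσc : |σ * c| = c := by rw [abs_mul, hσabs, one_mul, abs_of_pos hc0]
  have hpj : |p * (j : ℝ)| = p * |(j : ℝ)| := by rw [abs_mul, abs_of_pos hp]
  have hξlow : p * |(j : ℝ)| - c ≤ |ξ| := by
    have h' := abs_sub_abs_le_abs_sub (p * (j : ℝ)) (-(σ * c))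
    rw [sub_neg_eq_add, abs_neg, hpj, hσc, ← hξ] at h'
    linarith
  have hξne : ξ ≠ 0 := by
    rcases eq_or_ne j 0 with hj | hj
    · subst hj
      rw [hξ]
      simp only [Int.cast_zero, mul_zero, zero_add]
      intro h0
      rw [← hσc, h0, abs_zero] at hc0
      exact lt_irrefl _ hc0
    · have hj1 : (1 : ℝ) ≤ |(j : ℝ)| := by exact_mod_cast Int.one_le_abs hj
      have hpp : p ≤ p * |(j : ℝ)| := by nlinarith
      have hlt : c < |ξ| := by linarith
      intro h0
      rw [h0, abs_zero] at hlt
      linarith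
  rw [mvis_eq hξne]
  have habs : |4 * Real.sin (ξ * L / 2) * Real.sin (ξ * (2 - L) / 2) / ξ|
      = 4 * |Real.sin (ξ * L / 2)| * |Real.sin (ξ * (2 - L) / 2)| / |ξ| := by
    rw [abs_div, abs_mul, abs_mul, abs_of_pos (by norm_num : (0 : ℝ) < 4)]
  have hξpos : 0 < |ξ| := abs_pos.mpr hξne
  have hs1 : 0 ≤ |Real.sin (ξ * L / 2)| := abs_nonneg _
  have hs2 : 0 ≤ |Real.sin (ξ * (2 - L) / 2)| := abs_nonneg _
  unfold Bsh
  split_ifs with hnear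
  · -- near shells
    have h2 : |Real.sin (ξ * (2 - L) / 2)| ≤ |ξ| * (2 - L) / 2 := by
      have h := Real.abs_sin_le_abs (x := ξ * (2 - L) / 2)
      rwa [abs_div, abs_mul, abs_of_nonneg hs, abs_two] at h
    have hm : |4 * Real.sin (ξ * L / 2) * Real.sin (ξ * (2 - L) / 2) / ξ| ≤ c * L * (2 - L) := by
      rw [habs, div_le_iff₀ hξpos]
      have := mul_le_mul hsin h2 hs2 (by positivity)
      nlinarith
    calc (4 * Real.sin (ξ * L / 2) * Real.sin (ξ * (2 - L) / 2) / ξ) ^ 2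
        = |4 * Real.sin (ξ * L / 2) * Real.sin (ξ * (2 - L) / 2) / ξ| ^ 2 := (sq_abs _).symm
      _ ≤ (c * L * (2 - L)) ^ 2 := pow_le_pow_left₀ (abs_nonneg _) hm 2
      _ = 4 * c ^ 2 * L ^ 2 * ((2 - L) / 2) ^ 2 := by ring
  · -- far shells
    push Not at hnear
    have hden : 0 < p * |(j : ℝ)| - η := by nlinarith
    have h2 : |Real.sin (ξ * (2 - L) / 2)| ≤ 1 := Real.abs_sin_le_one _
    have hm : |4 * Real.sin (ξ * L / 2) * Real.sin (ξ * (2 - L) / 2) / ξ| ≤ 2 * c * L / (p * |(j : ℝ)| - η) := by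
      rw [habs, div_le_div_iff₀ hξpos hden]
      have h4 : 4 * |Real.sin (ξ * L / 2)| * |Real.sin (ξ * (2 - L) / 2)| ≤ 2 * c * L := by
        have := mul_le_mul hsin h2 hs2 (by positivity)
        nlinarith
      calc 4 * |Real.sin (ξ * L / 2)| * |Real.sin (ξ * (2 - L) / 2)| * (p * |(j : ℝ)| - η)
          ≤ 2 * c * L * (p * |(j : ℝ)| - η) := mul_le_mul_of_nonneg_right h4 hden.le
        _ ≤ 2 * c * L * |ξ| := mul_le_mul_of_nonneg_left (by linarith) (by positivity)
    calc (4 * Real.sin (ξ * L / 2) * Real.sin (ξ * (2 - L) / 2) / ξ) ^ 2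
        = |4 * Real.sin (ξ * L / 2) * Real.sin (ξ * (2 - L) / 2) / ξ| ^ 2 := (sq_abs _).symm
      _ ≤ (2 * c * L / (p * |(j : ℝ)| - η)) ^ 2 := pow_le_pow_left₀ (abs_nonneg _) hm 2
      _ = 4 * c ^ 2 * L ^ 2 * (1 / (p * |(j : ℝ)| - η) ^ 2) := by
        rw [div_pow]
        field_simp
        ring

/-- `Σ_{i<16} c_i²` for `c_i = (i+1)/20`: `= 1496/400 = 187/50`. -/
theorem sum_moff_sq_sixteen : ∑ i : Fin 16, moff (4 / 5) 16 i ^ 2 = 187 / 50 := by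
  have h : ∀ i : Fin 16, moff (4 / 5) 16 i ^ 2 = (fun n : ℕ ↦ (((n : ℝ) + 1) * ((4 / 5 : ℝ) / 16)) ^ 2) (i : ℕ) := by
    intro i
    simp [moff]
  rw [Finset.sum_congr rfl fun i _ ↦ h i, Fin.sum_univ_eq_sum_range (fun n : ℕ ↦ (((n : ℝ) + 1) * ((4 / 5 : ℝ) / 16)) ^ 2) 16]
  simp only [Finset.sum_range_succ, Finset.range_zero, Finset.sum_empty]
  push_cast
  norm_num

/-- **THE RING VISIBILITY SUM at `(p, η, q) = (18/5, 4/5, 16)`, masses `(2000, 50)` (`D = 1000`), `L = 5π/9`:**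
`Σ_k w_k·mvis(L, λ_k)² ≤ 680` (planets invisible; `16` moon pairs per planet; near/far shell majorant). -/
theorem rings_vis_sum_le {L : ℝ} (m : ℕ) (hpL : (18 / 5 : ℝ) * L = 2 * Real.pi) (hLlo : 1.745328 ≤ L) (hLhi : L ≤ 1.74533) :
    ∑ k, ringW 2000 50 16 m k * mvis L (ringLam (18 / 5) (4 / 5) 16 m k) ^ 2 ≤ 680 := by
  have hL2 : L ≤ 2 := by linarith
  rw [ring_sum (fun x w ↦ w * mvis L x ^ 2)]
  have hplanet : ∑ j : Fin (2 * m + 1), (2000 : ℝ) * mvis L (latt (18 / 5) m j) ^ 2 = 0 := by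
    apply Finset.sum_eq_zero
    intro j _
    unfold latt
    rw [mvis_planet hpL]
    ring
  rw [hplanet, zero_add]
  set K : ℝ := 5 * ((2 - L) / 2) ^ 2 + 2 * (1 / (18 / 5 : ℝ) ^ 2 / (5 / 2 - (4 / 5 : ℝ) / (18 / 5))) with hK
  have hB := sum_Bsh_le (a := (2 - L) / 2) (p := 18 / 5) (η := 4 / 5) (by norm_num) (by norm_num) (by norm_num) m
  rw [← hK] at hB
  have hci : ∀ i : Fin 16, 0 < moff (4 / 5) 16 i ∧ moff (4 / 5) 16 i ≤ 4 / 5 := by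
    intro i
    have hi : ((i : ℕ) : ℝ) + 1 ≤ 16 := by exact_mod_cast i.isLt
    refine ⟨by unfold moff; positivity, ?_⟩
    unfold moff
    push_cast
    nlinarith
  have hfam : ∀ i : Fin 16, ∑ j : Fin (2 * m + 1),
      ((50 : ℝ) * mvis L (latt (18 / 5) m j + moff (4 / 5) 16 i) ^ 2 + 50 * mvis L (latt (18 / 5) m j - moff (4 / 5) 16 i) ^ 2)
      ≤ 400 * L ^ 2 * K * moff (4 / 5) 16 i ^ 2 := by
    intro i
    obtain ⟨hc0, hcη⟩ := hci i
    have hterm : ∀ j : Fin (2 * m + 1),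
        (50 : ℝ) * mvis L (latt (18 / 5) m j + moff (4 / 5) 16 i) ^ 2 + 50 * mvis L (latt (18 / 5) m j - moff (4 / 5) 16 i) ^ 2
        ≤ 400 * L ^ 2 * moff (4 / 5) 16 i ^ 2 * Bsh ((2 - L) / 2) (18 / 5) (4 / 5) |((j : ℕ) : ℝ) - m| := by
      intro j
      have h1 := mvis_sq_ring_le (σ := 1) (j := (((j : ℕ) : ℤ) - (m : ℤ))) (ξ := latt (18 / 5) m j + moff (4 / 5) 16 i)
        (by norm_num) hpL hL2 hc0 hcη (by norm_num) (Or.inl rfl) (by unfold latt; ring)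
      have h2 := mvis_sq_ring_le (σ := -1) (j := (((j : ℕ) : ℤ) - (m : ℤ))) (ξ := latt (18 / 5) m j - moff (4 / 5) 16 i)
        (by norm_num) hpL hL2 hc0 hcη (by norm_num) (Or.inr rfl) (by unfold latt; ring)
      push_cast at h1 h2
      linarith
    calc ∑ j : Fin (2 * m + 1),
          ((50 : ℝ) * mvis L (latt (18 / 5) m j + moff (4 / 5) 16 i) ^ 2 + 50 * mvis L (latt (18 / 5) m j - moff (4 / 5) 16 i) ^ 2)
        ≤ ∑ j : Fin (2 * m + 1), 400 * L ^ 2 * moff (4 / 5) 16 i ^ 2 * Bsh ((2 - L) / 2) (18 / 5) (4 / 5) |((j : ℕ) : ℝ) - m| :=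
          Finset.sum_le_sum fun j _ ↦ hterm j
      _ = 400 * L ^ 2 * moff (4 / 5) 16 i ^ 2 * ∑ j : Fin (2 * m + 1), Bsh ((2 - L) / 2) (18 / 5) (4 / 5) |((j : ℕ) : ℝ) - m| := by
          rw [Finset.mul_sum]
      _ ≤ 400 * L ^ 2 * moff (4 / 5) 16 i ^ 2 * K := mul_le_mul_of_nonneg_left hB (by positivity)
      _ = 400 * L ^ 2 * K * moff (4 / 5) 16 i ^ 2 := by ring
  have htot : ∑ i : Fin 16, ∑ j : Fin (2 * m + 1),
      ((50 : ℝ) * mvis L (latt (18 / 5) m j + moff (4 / 5) 16 i) ^ 2 + 50 * mvis L (latt (18 / 5) m j - moff (4 / 5) 16 i) ^ 2)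
      ≤ 400 * L ^ 2 * K * (187 / 50) := by
    calc _ ≤ ∑ i : Fin 16, 400 * L ^ 2 * K * moff (4 / 5) 16 i ^ 2 := Finset.sum_le_sum fun i _ ↦ hfam i
      _ = 400 * L ^ 2 * K * ∑ i : Fin 16, moff (4 / 5) 16 i ^ 2 := by rw [Finset.mul_sum]
      _ = 400 * L ^ 2 * K * (187 / 50) := by rw [sum_moff_sq_sixteen]
  -- numerics: L² ≤ 3.04618, (2−L)² ≤ 0.064858, K ≤ 0.148824
  have hT : 2 * (1 / (18 / 5 : ℝ) ^ 2 / (5 / 2 - (4 / 5 : ℝ) / (18 / 5))) ≤ 0.067751 := by norm_num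
  have hs : 0.25467 ≤ 2 - L := by linarith
  have hs' : 2 - L ≤ 0.254672 := by linarith
  have hsq : ((2 - L) / 2) ^ 2 ≤ 0.0162145 := by nlinarith
  have hKle : K ≤ 0.148824 := by rw [hK]; linarith
  have hK0 : 0 ≤ K := by rw [hK]; positivity
  have hL2sq : L ^ 2 ≤ 3.04618 := by nlinarith
  have hfin : 400 * L ^ 2 * K * (187 / 50) ≤ 680 := by
    have h1 : L ^ 2 * K ≤ 3.04618 * 0.148824 := mul_le_mul hL2sq hKle hK0 (by norm_num)
    nlinarith
  exact htot.trans hfin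


end Summit.RiemannHypothesis.RiemannHypothesis.Theorems.Splittings.MassAwareSamplingCeiling
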